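import Summits.BirchSwinnertonDyer.Rank1Residual.ManinAdditive.PrimeShiftEqualiserLaw
import Summits.BirchSwinnertonDyer.BirchSwinnertonDyer.Theorems.ManinLocalTwoThreeThreeShiftGlue
import HarnessLib

/-!
# The PRIME-GENERIC descent engine, I: gluing along `G = B·A` and the normal subgroup `A⁺ = Γ(p) ∩ Γ₀(pn)`
# (route `ManinLocalTwoThree`, cell bsd-f2-manin; the LEAD's prime-generic shift-equaliser law T-p1-g11-2
# `ShiftEqualiser.PrimeShiftInvariantIsDiamond`, open content `p ≥ 5`, `p ∣ N` by
# `ShiftEqualiser.primeShiftInvariantIsDiamond_iff_five_le_dvd`; prover seat p3 gen 11)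

The seat's engines at `p = 3` (`ThreeShiftDescent.descent`) and `p = 2` (`TwoShift.descent`) glue `φ∘coshift` on
`A = {p ∣ b} ≤ Γ₀(M)` with `φ` on `B = Γ₀(pM)` along `Γ₀(M) = A·⟨T⟩`, using that `A` is NORMAL — true exactly because
`a ≡ d (mod p)` is automatic for `p ∣ 6`, and false for `p ≥ 5`.  The prime-generic engine (sibling
`…PrimeShiftDescentEngine.lean`) uses instead the normal subgroup **`A⁺ = Γ(p) ∩ Γ₀(pn) = {p ∣ b, p ∣ a − 1}`** (`subA`,
`subA_normal` — normal for EVERY `p`), inside `A₀ = {p ∣ b}` (`subA0`), glued to `B = Γ₀(p²n)` (`subB`) along `Γ₀(pn) = B·A⁺`.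
This file: §0 the abstract gluing lemma **`glueBA`** (`A ⊴ G`, `G = B·A`, `α` additive on `A` and `B`-conjugation invariant,
`β` additive on `B`, `α = β` on `A ∩ B` ⟹ a common additive extension); §1 the three subgroups, their explicit-entry
descriptions, `T^k ∈ B`, and the inverse of an explicit matrix.  Any `p n : ℕ`.
HONEST FRAMING: group theory of `Γ₀(N)` only; nothing about BSD, Manin's conjecture, C2/C3 or the LEAD's law is asserted.
Reference: cell memo HOME/MEMO-es.md §37.8; HOME/p1/CENSUS-shift-equaliser-p1-g11.md [cite: DarmonDiamondTaylor1995, Lemma 4.28 (p. 135)].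
-/


set_option autoImplicit false
set_option linter.dupNamespace false

open scoped MatrixGroups

open CongruenceSubgroup Matrix.SpecialLinearGroup
open Summit.BirchSwinnertonDyer.Rank1Residual.ManinAdditive.NineShiftEqualiser (slOf g0Of g0Of_congr)
open Summit.BirchSwinnertonDyer.Rank1Residual.ManinAdditive.ShiftEqualiser (IsAdd IsShiftInvariant RestrictsFrom)
open Summit.BirchSwinnertonDyer.BirchSwinnertonDyer.Theorems.ManinLocalTwoThree.ThreeShiftDescent (g0Of_mul det_mul_entries
  Tpow Tpow_mul_Tpow Tpow_zero Tpow_inv g0Of_mul_Tpow Tpow_one_mul_mul_Tpow_neg_one addOn_map_one addOn_map_inv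
  conj_invariant_of_generator conj_zpow_invariant)

namespace Summit.BirchSwinnertonDyer.BirchSwinnertonDyer.Theorems.ManinLocalTwoThree

namespace PrimeShift

/-! ### §0. Abstract gluing along `G = B·A` with `A` normal -/

section Abstract

variable {G : Type*} [Group G] {Z : Type*} [AddCommGroup Z]

/-- **Gluing a compatible pair along `G = B·A`.**  Let `A ⊴ G`, `B ≤ G` with every `g ∈ G` of the form `b·a` (`b ∈ B`,
`a ∈ A`), `α` additive on `A` and invariant under conjugation by `B`, `β` additive on `B`, `α = β` on `A ∩ B`.  Then
`W(b·a) := β(b) + α(a)` is well defined, additive on `G`, and restricts to `α` on `A` and to `β` on `B`. [folklore] -/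
theorem glueBA {A B : Subgroup G} (hA : A.Normal) {α β : G → Z}
    (hα : ∀ x ∈ A, ∀ y ∈ A, α (x * y) = α x + α y) (hβ : ∀ x ∈ B, ∀ y ∈ B, β (x * y) = β x + β y)
    (hC : ∀ x ∈ A, x ∈ B → α x = β x) (hinv : ∀ b ∈ B, ∀ a ∈ A, α (b * a * b⁻¹) = α a)
    (hBA : ∀ g : G, ∃ b ∈ B, b⁻¹ * g ∈ A) :
    ∃ W : G → Z, (∀ g h, W (g * h) = W g + W h) ∧ (∀ a ∈ A, W a = α a) ∧ (∀ b ∈ B, W b = β b) := by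
  classical
  choose bOf hbOfB hbOfA using hBA
  -- the value does not depend on the decomposition
  have key : ∀ g, ∀ b' ∈ B, b'⁻¹ * g ∈ A → β (bOf g) + α ((bOf g)⁻¹ * g) = β b' + α (b'⁻¹ * g) := by
    intro g b' hb' hb'A
    have hq : b'⁻¹ * bOf g ∈ A := by
      have e : b'⁻¹ * bOf g = (b'⁻¹ * g) * ((bOf g)⁻¹ * g)⁻¹ := by group
      rw [e]; exact A.mul_mem hb'A (A.inv_mem (hbOfA g))
    have hqB : b'⁻¹ * bOf g ∈ B := B.mul_mem (B.inv_mem hb') (hbOfB g)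
    have e1 : α (b'⁻¹ * g) = α (b'⁻¹ * bOf g) + α ((bOf g)⁻¹ * g) := by
      rw [← hα _ hq _ (hbOfA g)]; congr 1; group
    have e2 : α (b'⁻¹ * bOf g) = -β b' + β (bOf g) := by
      rw [hC _ hq hqB, hβ _ (B.inv_mem hb') _ (hbOfB g), addOn_map_inv hβ hb']
    rw [e1, e2]; abel
  refine ⟨fun g => β (bOf g) + α ((bOf g)⁻¹ * g), ?_, ?_, ?_⟩
  · intro g h
    have hb' : bOf g * bOf h ∈ B := B.mul_mem (hbOfB g) (hbOfB h)
    have hconj : (bOf h)⁻¹ * ((bOf g)⁻¹ * g) * (bOf h)⁻¹⁻¹ ∈ A := hA.conj_mem _ (hbOfA g) _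
    have e : (bOf g * bOf h)⁻¹ * (g * h) = ((bOf h)⁻¹ * ((bOf g)⁻¹ * g) * (bOf h)⁻¹⁻¹) * ((bOf h)⁻¹ * h) := by group
    have hb'A : (bOf g * bOf h)⁻¹ * (g * h) ∈ A := by rw [e]; exact A.mul_mem hconj (hbOfA h)
    show β (bOf (g * h)) + α ((bOf (g * h))⁻¹ * (g * h)) =
      (β (bOf g) + α ((bOf g)⁻¹ * g)) + (β (bOf h) + α ((bOf h)⁻¹ * h))
    rw [key (g * h) _ hb' hb'A, hβ _ (hbOfB g) _ (hbOfB h), e, hα _ hconj _ (hbOfA h),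
      hinv _ (B.inv_mem (hbOfB h)) _ (hbOfA g)]
    abel
  · intro a ha
    show β (bOf a) + α ((bOf a)⁻¹ * a) = α a
    rw [key a 1 B.one_mem (by simpa using ha), addOn_map_one hβ, inv_one, one_mul, zero_add]
  · intro b hb
    show β (bOf b) + α ((bOf b)⁻¹ * b) = β b
    rw [key b b hb (by rw [inv_mul_cancel]; exact A.one_mem), inv_mul_cancel, addOn_map_one hα, add_zero]

end Abstract

/-! ### §1. The concrete pair `A⁺ = Γ(p) ∩ Γ₀(pn) ⊆ A₀ = {p ∣ b}`, `B = Γ₀(p²n)` inside `Γ₀(pn)` -/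

section Concrete

variable (p n : ℕ)

/-- `p ∣ pn ∣ c` for every element of `Γ₀(pn)`. [folklore] -/
theorem p_dvd_c (γ : Gamma0 (p * n)) : (p : ℤ) ∣ ((γ : SL(2, ℤ)) 1 0 : ℤ) :=
  (show (p : ℤ) ∣ ((p * n : ℕ) : ℤ) from ⟨n, by push_cast; ring⟩).trans
    ((ZMod.intCast_zmod_eq_zero_iff_dvd _ _).mp (Gamma0_mem.mp γ.2))

/-- `A₀ = {γ ∈ Γ₀(pn) : p ∣ b_γ}` = `diag(p,1) Γ₀(p²n) diag(p,1)⁻¹` (NOT normal for `p ≥ 5`). [folklore] -/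
def subA0 : Subgroup (Gamma0 (p * n)) where
  carrier := {γ | (p : ℤ) ∣ ((γ : SL(2, ℤ)) 0 1 : ℤ)}
  mul_mem' := by
    intro x y hx hy
    simp only [Set.mem_setOf_eq] at hx hy ⊢
    have e : (((x * y : Gamma0 (p * n)) : SL(2, ℤ)) 0 1 : ℤ) =
        (x : SL(2, ℤ)) 0 0 * (y : SL(2, ℤ)) 0 1 + (x : SL(2, ℤ)) 0 1 * (y : SL(2, ℤ)) 1 1 := by
      simp [Matrix.mul_apply, Fin.sum_univ_two]
    rw [e]
    exact dvd_add (Dvd.dvd.mul_left hy _) (Dvd.dvd.mul_right hx _)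
  one_mem' := by simp
  inv_mem' := by
    intro x hx
    simp only [Set.mem_setOf_eq] at hx ⊢
    have e : (((x⁻¹ : Gamma0 (p * n)) : SL(2, ℤ)) 0 1 : ℤ) = -((x : SL(2, ℤ)) 0 1) := by
      simp [Matrix.SpecialLinearGroup.coe_inv, Matrix.adjugate_fin_two]
    rw [e]
    exact hx.neg_right

/-- Membership in `A₀`. [folklore] -/
theorem mem_subA0 {γ : Gamma0 (p * n)} : γ ∈ subA0 p n ↔ (p : ℤ) ∣ ((γ : SL(2, ℤ)) 0 1 : ℤ) := Iff.rfl

/-- For `γ ∈ A₀`: `p ∣ d_γ − a_γ·?` — precisely, `p ∣ a − 1 ↔ p ∣ d − 1` (`ad ≡ 1`, `p ∣ b`). [folklore] -/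
theorem dvd_d_sub_one {γ : Gamma0 (p * n)} (hb : (p : ℤ) ∣ ((γ : SL(2, ℤ)) 0 1 : ℤ))
    (ha : (p : ℤ) ∣ ((γ : SL(2, ℤ)) 0 0 : ℤ) - 1) : (p : ℤ) ∣ ((γ : SL(2, ℤ)) 1 1 : ℤ) - 1 := by
  have e : ((γ : SL(2, ℤ)) 1 1 : ℤ) - 1 = -((((γ : SL(2, ℤ)) 0 0 : ℤ) - 1) * (γ : SL(2, ℤ)) 1 1) +
      ((γ : SL(2, ℤ)) 0 1 : ℤ) * (γ : SL(2, ℤ)) 1 0 +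
      ((((γ : SL(2, ℤ)) 0 0 : ℤ) * (γ : SL(2, ℤ)) 1 1 - ((γ : SL(2, ℤ)) 0 1 : ℤ) * (γ : SL(2, ℤ)) 1 0) - 1) := by ring
  rw [e, gamma0_det_entries γ, sub_self, add_zero]
  exact dvd_add (Dvd.dvd.mul_right ha _).neg_right (Dvd.dvd.mul_right hb _)

/-- **`A⁺ = Γ(p) ∩ Γ₀(pn) = {γ : p ∣ b_γ, p ∣ a_γ − 1}`**, as a subgroup of `Γ₀(pn)`. [folklore] -/
def subA : Subgroup (Gamma0 (p * n)) where
  carrier := {γ | (p : ℤ) ∣ ((γ : SL(2, ℤ)) 0 1 : ℤ) ∧ (p : ℤ) ∣ ((γ : SL(2, ℤ)) 0 0 : ℤ) - 1}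
  mul_mem' := by
    intro x y hx hy
    simp only [Set.mem_setOf_eq] at hx hy ⊢
    have e1 : (((x * y : Gamma0 (p * n)) : SL(2, ℤ)) 0 1 : ℤ) =
        (x : SL(2, ℤ)) 0 0 * (y : SL(2, ℤ)) 0 1 + (x : SL(2, ℤ)) 0 1 * (y : SL(2, ℤ)) 1 1 := by
      simp [Matrix.mul_apply, Fin.sum_univ_two]
    have e0 : (((x * y : Gamma0 (p * n)) : SL(2, ℤ)) 0 0 : ℤ) - 1 =
        (((x : SL(2, ℤ)) 0 0 : ℤ) - 1) * (y : SL(2, ℤ)) 0 0 + (((y : SL(2, ℤ)) 0 0 : ℤ) - 1) +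
          (x : SL(2, ℤ)) 0 1 * (y : SL(2, ℤ)) 1 0 := by
      simp [Matrix.mul_apply, Fin.sum_univ_two]; ring
    rw [e1, e0]
    exact ⟨dvd_add (Dvd.dvd.mul_left hy.1 _) (Dvd.dvd.mul_right hx.1 _),
      dvd_add (dvd_add (Dvd.dvd.mul_right hx.2 _) hy.2) (Dvd.dvd.mul_right hx.1 _)⟩
  one_mem' := by simp
  inv_mem' := by
    intro x hx
    simp only [Set.mem_setOf_eq] at hx ⊢
    have e1 : (((x⁻¹ : Gamma0 (p * n)) : SL(2, ℤ)) 0 1 : ℤ) = -((x : SL(2, ℤ)) 0 1) := by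
      simp [Matrix.SpecialLinearGroup.coe_inv, Matrix.adjugate_fin_two]
    have e0 : (((x⁻¹ : Gamma0 (p * n)) : SL(2, ℤ)) 0 0 : ℤ) = (x : SL(2, ℤ)) 1 1 := by
      simp [Matrix.SpecialLinearGroup.coe_inv, Matrix.adjugate_fin_two]
    rw [e1, e0]
    exact ⟨hx.1.neg_right, dvd_d_sub_one p n hx.1 hx.2⟩

/-- Membership in `A⁺`. [folklore] -/
theorem mem_subA {γ : Gamma0 (p * n)} :
    γ ∈ subA p n ↔ (p : ℤ) ∣ ((γ : SL(2, ℤ)) 0 1 : ℤ) ∧ (p : ℤ) ∣ ((γ : SL(2, ℤ)) 0 0 : ℤ) - 1 := Iff.rfl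

/-- `A⁺ ≤ A₀`. [folklore] -/
theorem subA_le_subA0 : subA p n ≤ subA0 p n := fun _ hx => hx.1

/-- **`A⁺` is normal in `Γ₀(pn)`** (it is `Γ₀(pn) ∩ Γ(p)`: `γ ≡ 1 (mod p)` entrywise). [folklore] -/
theorem subA_normal : (subA p n).Normal := by
  refine ⟨fun x hx g => ?_⟩
  obtain ⟨hb, ha⟩ := hx
  have hc : (p : ℤ) ∣ (x : SL(2, ℤ)) 1 0 := p_dvd_c p n x
  have hd : (p : ℤ) ∣ ((x : SL(2, ℤ)) 1 1 : ℤ) - 1 := dvd_d_sub_one p n hb ha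
  have hg := gamma0_det_entries g
  rw [mem_subA]
  have e1 : (((g * x * g⁻¹ : Gamma0 (p * n)) : SL(2, ℤ)) 0 1 : ℤ) =
      (g : SL(2, ℤ)) 0 0 * (g : SL(2, ℤ)) 0 1 * ((((x : SL(2, ℤ)) 1 1 : ℤ) - 1) - (((x : SL(2, ℤ)) 0 0 : ℤ) - 1)) +
        (g : SL(2, ℤ)) 0 0 * (g : SL(2, ℤ)) 0 0 * (x : SL(2, ℤ)) 0 1 -
        (g : SL(2, ℤ)) 0 1 * (g : SL(2, ℤ)) 0 1 * (x : SL(2, ℤ)) 1 0 := by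
    simp [Matrix.mul_apply, Fin.sum_univ_two, Matrix.SpecialLinearGroup.coe_inv, Matrix.adjugate_fin_two]
    ring
  have e0 : (((g * x * g⁻¹ : Gamma0 (p * n)) : SL(2, ℤ)) 0 0 : ℤ) - 1 =
      (g : SL(2, ℤ)) 0 0 * (g : SL(2, ℤ)) 1 1 * (((x : SL(2, ℤ)) 0 0 : ℤ) - 1) -
        (g : SL(2, ℤ)) 0 1 * (g : SL(2, ℤ)) 1 0 * (((x : SL(2, ℤ)) 1 1 : ℤ) - 1) +
        (g : SL(2, ℤ)) 0 1 * (g : SL(2, ℤ)) 1 1 * (x : SL(2, ℤ)) 1 0 -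
        (g : SL(2, ℤ)) 0 0 * (g : SL(2, ℤ)) 1 0 * (x : SL(2, ℤ)) 0 1 +
        ((((g : SL(2, ℤ)) 0 0 : ℤ) * (g : SL(2, ℤ)) 1 1 - ((g : SL(2, ℤ)) 0 1 : ℤ) * (g : SL(2, ℤ)) 1 0) - 1) := by
    simp [Matrix.mul_apply, Fin.sum_univ_two, Matrix.SpecialLinearGroup.coe_inv, Matrix.adjugate_fin_two]
    ring
  rw [e1, e0, hg, sub_self, add_zero]
  exact ⟨dvd_sub (dvd_add (Dvd.dvd.mul_left (dvd_sub hd ha) _) (Dvd.dvd.mul_left hb _)) (Dvd.dvd.mul_left hc _),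
    dvd_sub (dvd_add (dvd_sub (Dvd.dvd.mul_left ha _) (Dvd.dvd.mul_left hd _)) (Dvd.dvd.mul_left hc _))
      (Dvd.dvd.mul_left hb _)⟩

/-- `B = Γ₀(p²n)` as a subgroup of `Γ₀(pn)`. [folklore] -/
def subB : Subgroup (Gamma0 (p * n)) where
  carrier := {γ | ((p * (p * n) : ℕ) : ℤ) ∣ ((γ : SL(2, ℤ)) 1 0 : ℤ)}
  mul_mem' := by
    intro x y hx hy
    simp only [Set.mem_setOf_eq] at hx hy ⊢
    have e : (((x * y : Gamma0 (p * n)) : SL(2, ℤ)) 1 0 : ℤ) =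
        (x : SL(2, ℤ)) 1 0 * (y : SL(2, ℤ)) 0 0 + (x : SL(2, ℤ)) 1 1 * (y : SL(2, ℤ)) 1 0 := by
      simp [Matrix.mul_apply, Fin.sum_univ_two]
    rw [e]
    exact dvd_add (Dvd.dvd.mul_right hx _) (Dvd.dvd.mul_left hy _)
  one_mem' := by simp
  inv_mem' := by
    intro x hx
    simp only [Set.mem_setOf_eq] at hx ⊢
    have e : (((x⁻¹ : Gamma0 (p * n)) : SL(2, ℤ)) 1 0 : ℤ) = -((x : SL(2, ℤ)) 1 0) := by
      simp [Matrix.SpecialLinearGroup.coe_inv, Matrix.adjugate_fin_two]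
    rw [e]
    exact hx.neg_right

/-- Membership in `B`. [folklore] -/
theorem mem_subB {γ : Gamma0 (p * n)} : γ ∈ subB p n ↔ ((p * (p * n) : ℕ) : ℤ) ∣ ((γ : SL(2, ℤ)) 1 0 : ℤ) :=
  Iff.rfl

variable {p n}

/-- An element of `A₀` is `(a, pb; c, d)`. [folklore] -/
theorem exists_eq_of_mem_subA0 {x : Gamma0 (p * n)} (hx : x ∈ subA0 p n) :
    ∃ (a b c d : ℤ) (h : a * d - (p * b) * c = 1) (hc : ((p * n : ℕ) : ℤ) ∣ c), x = g0Of a (p * b) c d h hc := by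
  obtain ⟨b, hb⟩ := (mem_subA0 p n).mp hx
  have hdet := gamma0_det_entries x
  rw [hb] at hdet
  refine ⟨_, b, _, _, hdet, ((ZMod.intCast_zmod_eq_zero_iff_dvd _ _).mp (Gamma0_mem.mp x.2)), ?_⟩
  calc x = g0Of ((x : SL(2, ℤ)) 0 0) ((x : SL(2, ℤ)) 0 1) ((x : SL(2, ℤ)) 1 0) ((x : SL(2, ℤ)) 1 1)
        (gamma0_det_entries x) ((ZMod.intCast_zmod_eq_zero_iff_dvd _ _).mp (Gamma0_mem.mp x.2)) :=
      (g0Of_entries x (gamma0_det_entries x) ((ZMod.intCast_zmod_eq_zero_iff_dvd _ _).mp (Gamma0_mem.mp x.2))).symm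
    _ = _ := g0Of_congr rfl hb rfl rfl _ _ _ _

/-- An element of `B` is `(a, b; c, d)` with `p²n ∣ c`. [folklore] -/
theorem exists_eq_of_mem_subB {x : Gamma0 (p * n)} (hx : x ∈ subB p n) :
    ∃ (a b c d : ℤ) (h : a * d - b * c = 1) (hc : ((p * n : ℕ) : ℤ) ∣ c),
      ((p * (p * n) : ℕ) : ℤ) ∣ c ∧ x = g0Of a b c d h hc :=
  ⟨_, _, _, _, gamma0_det_entries x, ((ZMod.intCast_zmod_eq_zero_iff_dvd _ _).mp (Gamma0_mem.mp x.2)), (mem_subB p n).mp hx,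
    (g0Of_entries x (gamma0_det_entries x) ((ZMod.intCast_zmod_eq_zero_iff_dvd _ _).mp (Gamma0_mem.mp x.2))).symm⟩

/-- Every element is `g0Of` of some entries. [folklore] -/
theorem exists_eq_g0Of (x : Gamma0 (p * n)) :
    ∃ (a b c d : ℤ) (h : a * d - b * c = 1) (hc : ((p * n : ℕ) : ℤ) ∣ c), x = g0Of a b c d h hc :=
  ⟨_, _, _, _, gamma0_det_entries x, ((ZMod.intCast_zmod_eq_zero_iff_dvd _ _).mp (Gamma0_mem.mp x.2)),
    (g0Of_entries x (gamma0_det_entries x) ((ZMod.intCast_zmod_eq_zero_iff_dvd _ _).mp (Gamma0_mem.mp x.2))).symm⟩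

/-- `g0Of a (pb) c d ∈ A₀`. [folklore] -/
theorem g0Of_mem_subA0 (a b c d : ℤ) (h : a * d - (p * b) * c = 1) (hc : ((p * n : ℕ) : ℤ) ∣ c) :
    (g0Of a (p * b) c d h hc : Gamma0 (p * n)) ∈ subA0 p n :=
  (mem_subA0 p n).mpr ⟨b, rfl⟩

/-- `g0Of a b c d ∈ B` when `p²n ∣ c`. [folklore] -/
theorem g0Of_mem_subB (a b c d : ℤ) (h : a * d - b * c = 1) (hc : ((p * n : ℕ) : ℤ) ∣ c)
    (hc' : ((p * (p * n) : ℕ) : ℤ) ∣ c) : (g0Of a b c d h hc : Gamma0 (p * n)) ∈ subB p n :=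
  (mem_subB p n).mpr hc'

/-- `T^k ∈ B`. [folklore] -/
theorem Tpow_mem_subB (k : ℤ) : (Tpow (p * n) k) ∈ subB p n := (mem_subB p n).mpr (dvd_zero _)

/-- `(T^1)^k = T^k`. [folklore] -/
theorem Tpow_one_zpow (k : ℤ) : (Tpow (p * n) 1) ^ k = Tpow (p * n) k := by
  induction k using Int.induction_on with
  | zero => rw [zpow_zero, Tpow_zero]
  | succ m ih => rw [zpow_add_one, ih, Tpow_mul_Tpow]
  | pred m ih => rw [zpow_sub_one, ih, Tpow_inv, Tpow_mul_Tpow]; ring_nf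

/-- The inverse of an explicit matrix. [folklore] -/
theorem g0Of_inv (a b c d : ℤ) (h : a * d - b * c = 1) (hc : ((p * n : ℕ) : ℤ) ∣ c) :
    (g0Of a b c d h hc : Gamma0 (p * n))⁻¹ = g0Of d (-b) (-c) a (by linear_combination h) hc.neg_right := by
  apply Subtype.ext
  ext i j
  fin_cases i <;> fin_cases j <;>
    simp [g0Of, slOf, Matrix.SpecialLinearGroup.coe_inv, Matrix.adjugate_fin_two]

end Concrete

end PrimeShift

end Summit.BirchSwinnertonDyer.BirchSwinnertonDyer.Theorems.ManinLocalTwoThree
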